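import Mathlib.Analysis.SpecialFunctions.SmoothTransition
import Literature.Topology.FourManifolds.SphereHypersurfaceCollar
import Literature.Topology.FourManifolds.SchoenfliesSeparation
import Literature.Topology.FourManifolds.RegularLevelSplitting
import Literature.Topology.FourManifolds.SmoothEmbeddingCriteria
import HarnessLib

/-!
# The two sides of a smoothly embedded codimension-one sphere in a sphere

Topic `Literature/Topology/FourManifolds` (fact seat of the Schoenflies theorem in `S³`,
`Literature.Topology.FourManifolds.SphereEmbedding.schoenflies_exists_ambientIsotopy_image_eq_sphereEquator`
/ `SphereEmbedding.schoenflies_exists_ball`, `SchoenfliesSphereThree.lean`: Schultens,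
*Introduction to 3-Manifolds* (2014), Thm. 3.2.5 "any 2-sphere in `ℝ³` bounds a 3-ball" with
Cor. 3.2.6 and §4.1).  **Everything in this file is proved; no named fact is introduced.**

The printed proof of Thm. 3.2.5 (after Casson; PDF pp. 43–45 of the held copy) and every other
proof of Alexander's theorem manipulate *the region bounded by* an embedded sphere ("`S` bounds a
3-ball", "`c ∪ D₁ ∪ D₂` bounds a 3-ball in `M`", Lemma 3.2.3) as a compact 3-manifold with
boundary the sphere.  The tree proves Brown's generalized Schoenflies theorem
(`SchoenfliesSeparation.lean`, Daverman Thm. II.6.6: the closed complementary domains of a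
*bicollared* sphere in `Sⁿ`, `n ≥ 2`, are topological `n`-cells) and that smoothly embedded
codimension-one spheres are bicollared (`SphereHypersurfaceCollar.lean`, via the framed tubular
neighbourhood theorem of `FramedTubularNbhd.lean`).  This file turns that topological output into
the smooth object the Schoenflies theorem is about: for a smooth embedding `f : 𝕊 m → 𝕊 (m+1)`,
`m ≥ 1`,

* `SphereHypersurfaceSides.exists_isSidePackage` / `exists_isRegularLevel_sides` (**main
  theorem**): there is a smooth function `g : 𝕊 (m+1) → ℝ` having `0` as a regular level
  (`Literature.Topology.FourManifolds.IsRegularLevel`) with `g⁻¹(0) = f(𝕊 m)`, whose open sides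
  `{g > 0}`, `{g < 0}` are connected — they are the two complementary components of `f(𝕊 m)`
  (`IsSidePackage.connectedComponentIn_eq_pos/neg`, `exists_two_sides`: Jordan–Brouwer separation
  for smooth hypersurface spheres) — with closures `{g ≥ 0}`, `{g ≤ 0}`, both homeomorphic to the
  closed `(m+1)`-ball (Brown);
* `SphereHypersurfaceSides.exists_isRegularLevel_regularSublevel`,
  `SphereEmbedding.exists_sides_two_three` (**the sides as manifolds with boundary**): hence the
  regular sublevel and superlevel manifolds `W = {g ≤ 0}`, `W' = {g ≥ 0}`
  (`Literature.Topology.FourManifolds.RegularSublevel`, `RegularLevelSplitting.lean`: compact smooth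
  `(m+1)`-manifolds with boundary modelled on `𝓡∂ (m+1)`, glued along `g⁻¹(0)` to give `𝕊 (m+1)`,
  `RegularSublevel.isBoundaryGluing_split`) are connected, contractible, homeomorphic to
  `𝔻^{m+1}`, with boundary exactly the points of `f(𝕊 m)` — "the sphere bounds, on both sides".
  For `m = 2` these are the two compact regions of `S³` bounded by a smooth 2-sphere, of which
  Thm. 3.2.5/Cor. 3.2.6 assert that they are smooth 3-balls (the smooth identification with `𝔻³`
  is Alexander's theorem and is **not** proved here); for `m = 1` they are the two closed discs of
  the smooth Schoenflies theorem on `S²`, to which the tree's Morse-theoretic disc classification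
  (`nonempty_diffeomorph_closedBall_of_bettiOne_eq_zero_of_facts`, `SliceGenusDiscMorse.lean`)
  applies once its cancellation leaves are discharged;
* `SphereHypersurfaceSides.exists_isSidePackage_neg`: the side function may be chosen negative at
  a prescribed point off the hypersurface (the normalisation "the ball misses `p`" of
  `schoenflies_exists_ball`).

## Construction (§§2–8)

Let `τ : 𝕊 m × ℝ¹ → 𝕊 (m+1)` be the tube of the normal framing of `f` by its normal field
(`SphereHypersurface.isNormalFraming_normalField`,
`IsNormalFraming.exists_isSmoothEmbedding_tube_of_isSmoothEmbedding`; Hirsch, Ch. 4 §5,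
Thms. 5.1–5.2): a smooth embedding with open range and `τ(x, 0) = f x` (`TubeData`,
`nonempty_tubeData`).  Its restriction `h(x, t) = τ(x, t e₀)`, `t ∈ [-1, 1]`, is a continuous
injective collar of `f(𝕊 m) = h(𝕊 m × {0})`, so by the separation theorem
`IsTopSphere.isBicollarSides_collarSide` Daverman's far sides `A = collarSide h`,
`B = collarSide (h ∘ flip)` exist (`TubeData.isBicollarSides`).  The **side function** is
`g = 1` on `A`, `g = -1` on `B`, and `g(h(x, t)) = β(t)` on the collar, where `β` (§1,
`satProfile`, built from `Real.smoothTransition`) is a smooth saturating profile with `β(t) = t`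
for `|t| ≤ 1/4`, `β = ±1` for `|t| ≥ 1/2` and `sign β(t) = sign t`.  Then `g` is smooth (it is
locally either constant or `β ∘ (height of τ⁻¹)`, §6), `g⁻¹(0) = f(𝕊 m)` and along each fibre
`t ↦ τ(x, t e₀)` one has `g = t` near `0`, so `dg ≠ 0` on the level (§7); the level sets of `g`
are Daverman's `D_A ∖ Σ`, `D_A`, `D_B ∖ Σ`, `D_B` (§5), which are connected resp. cells by
`SchoenfliesSeparation.lean` / `SchoenfliesBrown.lean` (§8).

## References

* J. Schultens, *Introduction to 3-Manifolds*, GSM 151, AMS (2014), Thm. 3.2.5 and its proof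
  (PDF pp. 43–45 of the held copy `book:schultens2014-introduction-3-manifolds`), Cor. 3.2.6
  (PDF p. 45). [Schultens2014]
* R. J. Daverman, *Decompositions of manifolds*, Academic Press (1986), §II.6, Thm. 6 and its
  proof (PDF p. 40). [Daverman1986]
* M. W. Hirsch, *Differential Topology*, GTM 33 (1976), Ch. 4 §5, Thms. 5.1–5.2 (tubular
  neighbourhoods); Ch. 1 §3–§4 (regular values). [HirschDT1976]
* J. Milnor, *Morse theory*, Ann. of Math. Studies 51 (1963), Thm. 3.1 (`Mᵃ` is a smooth manifold
  with boundary `f⁻¹(a)`). [Milnor1963]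

## Design notes

* `TubeData f` (an open bicollar `τ` of `f` with its three properties) and `IsSidePackage Z g`
  (the eight conclusions about a side function) are proof infrastructure — an explicit-map
  structure and a `Prop`-valued *predicate* with explicit parameters — not named facts; both are
  inhabited here (`nonempty_tubeData`, `TubeData.isSidePackage_sideFun`, `exists_isSidePackage`).
* Everything is stated for unbundled smooth embeddings `f : 𝕊 m → 𝕊 (m+1)` (as in
  `SphereHypersurfaceCollar.lean`) and then specialised to the bundled `SphereEmbedding m (m+1)`
  of `Knots.lean` (§10).  The hypothesis `1 ≤ m` is Brown's `n = m + 1 ≥ 2` (for `m = 0` two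
  points of `S¹` do separate, but the separation theorem used here is stated for `n ≥ 2`).
* The superlevel side `{g ≥ 0}` is presented, as everywhere in the tree, as the regular sublevel
  manifold of `0 - g` (`RegularSuperlevel`); `IsSidePackage.neg` exchanges the two sides.
-/

open scoped Manifold ContDiff Topology
open Set Function Metric Module Filter

noncomputable section

namespace Literature.Topology.FourManifolds

/-- Local notation: `𝔼 n` is the model Euclidean space `EuclideanSpace ℝ (Fin n)`. -/
local notation "𝔼 " n:arg => EuclideanSpace ℝ (Fin n)

/-- Local notation: `𝕊 n` is the unit sphere in `EuclideanSpace ℝ (Fin (n + 1))`. -/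
local notation "𝕊 " n:arg => (Metric.sphere (0 : EuclideanSpace ℝ (Fin (n + 1))) 1)

namespace SphereHypersurfaceSides

/-! ### §1 The saturating height profile -/

open Real in
/-- The plateau bump `ψ(t) = S(4t + 2) S(2 - 4t)` (`S` = `Real.smoothTransition`): smooth,
valued in `[0, 1]`, equal to `1` on `[-1/4, 1/4]` and to `0` outside `(-1/2, 1/2)`. [folklore] -/
def plateau (t : ℝ) : ℝ := smoothTransition (4 * t + 2) * smoothTransition (2 - 4 * t)

open Real in
/-- The sign profile `σ(t) = S(4t) - S(-4t)`: smooth, odd-shaped, valued in `[-1, 1]`, with the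
sign of `t`, equal to `1` for `t ≥ 1/4` and to `-1` for `t ≤ -1/4`. [folklore] -/
def signProfile (t : ℝ) : ℝ := smoothTransition (4 * t) - smoothTransition (-(4 * t))

/-- The **saturating coordinate profile** `β = ψ · id + (1 - ψ) · σ`: smooth, `β(t) = t` for
`|t| ≤ 1/4`, `β(t) = 1` for `t ≥ 1/2`, `β(t) = -1` for `t ≤ -1/2`, and `β` has the sign of `t`
everywhere. [folklore] -/
def satProfile (t : ℝ) : ℝ := plateau t * t + (1 - plateau t) * signProfile t

/-- The plateau bump is smooth. [folklore] -/
theorem contDiff_plateau : ContDiff ℝ ∞ plateau := by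
  unfold plateau
  exact ((Real.smoothTransition.contDiff (n := ⊤)).comp (by fun_prop)).mul
    ((Real.smoothTransition.contDiff (n := ⊤)).comp (by fun_prop))

/-- The sign profile is smooth. [folklore] -/
theorem contDiff_signProfile : ContDiff ℝ ∞ signProfile := by
  unfold signProfile
  exact ((Real.smoothTransition.contDiff (n := ⊤)).comp (by fun_prop)).sub
    ((Real.smoothTransition.contDiff (n := ⊤)).comp (by fun_prop))

/-- The saturating profile is smooth. [folklore] -/
theorem contDiff_satProfile : ContDiff ℝ ∞ satProfile := by
  unfold satProfile
  exact (contDiff_plateau.mul contDiff_id).add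
    ((contDiff_const.sub contDiff_plateau).mul contDiff_signProfile)

/-- `0 ≤ ψ`. [folklore] -/
theorem plateau_nonneg (t : ℝ) : 0 ≤ plateau t :=
  mul_nonneg (Real.smoothTransition.nonneg _) (Real.smoothTransition.nonneg _)

/-- `ψ ≤ 1`. [folklore] -/
theorem plateau_le_one (t : ℝ) : plateau t ≤ 1 :=
  mul_le_one₀ (Real.smoothTransition.le_one _) (Real.smoothTransition.nonneg _)
    (Real.smoothTransition.le_one _)

/-- `ψ = 1` on `[-1/4, 1/4]`. [folklore] -/
theorem plateau_eq_one {t : ℝ} (ht : |t| ≤ 1 / 4) : plateau t = 1 := by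
  obtain ⟨h1, h2⟩ := abs_le.1 ht
  rw [plateau, Real.smoothTransition.one_of_one_le (by linarith),
    Real.smoothTransition.one_of_one_le (by linarith), mul_one]

/-- `ψ = 0` on `[1/2, ∞)`. [folklore] -/
theorem plateau_eq_zero_of_le {t : ℝ} (ht : 1 / 2 ≤ t) : plateau t = 0 := by
  rw [plateau, Real.smoothTransition.zero_of_nonpos (x := 2 - 4 * t) (by linarith), mul_zero]

/-- `ψ = 0` on `(-∞, -1/2]`. [folklore] -/
theorem plateau_eq_zero_of_le_neg {t : ℝ} (ht : t ≤ -(1 / 2)) : plateau t = 0 := by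
  rw [plateau, Real.smoothTransition.zero_of_nonpos (x := 4 * t + 2) (by linarith), zero_mul]

/-- `σ(0) = 0`. [folklore] -/
theorem signProfile_zero : signProfile 0 = 0 := by simp [signProfile]

/-- `σ > 0` on `(0, ∞)`. [folklore] -/
theorem signProfile_pos {t : ℝ} (ht : 0 < t) : 0 < signProfile t := by
  rw [signProfile, Real.smoothTransition.zero_of_nonpos (x := -(4 * t)) (by linarith), sub_zero]
  exact Real.smoothTransition.pos_of_pos (by linarith)

/-- `σ < 0` on `(-∞, 0)`. [folklore] -/
theorem signProfile_neg {t : ℝ} (ht : t < 0) : signProfile t < 0 := by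
  rw [signProfile, Real.smoothTransition.zero_of_nonpos (x := 4 * t) (by linarith), zero_sub,
    neg_lt_zero]
  exact Real.smoothTransition.pos_of_pos (by linarith)

/-- `σ = 1` on `[1/4, ∞)`. [folklore] -/
theorem signProfile_eq_one {t : ℝ} (ht : 1 / 4 ≤ t) : signProfile t = 1 := by
  rw [signProfile, Real.smoothTransition.one_of_one_le (by linarith),
    Real.smoothTransition.zero_of_nonpos (x := -(4 * t)) (by linarith), sub_zero]

/-- `σ = -1` on `(-∞, -1/4]`. [folklore] -/
theorem signProfile_eq_neg_one {t : ℝ} (ht : t ≤ -(1 / 4)) : signProfile t = -1 := by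
  rw [signProfile, Real.smoothTransition.zero_of_nonpos (x := 4 * t) (by linarith),
    Real.smoothTransition.one_of_one_le (x := -(4 * t)) (by linarith), zero_sub]

/-- `β(t) = t` for `|t| ≤ 1/4`. [folklore] -/
theorem satProfile_eq_self {t : ℝ} (ht : |t| ≤ 1 / 4) : satProfile t = t := by
  rw [satProfile, plateau_eq_one ht]; ring

/-- `β(0) = 0`. [folklore] -/
theorem satProfile_zero : satProfile 0 = 0 :=
  satProfile_eq_self (by norm_num)

/-- `β = 1` on `[1/2, ∞)`. [folklore] -/
theorem satProfile_eq_one {t : ℝ} (ht : 1 / 2 ≤ t) : satProfile t = 1 := by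
  rw [satProfile, plateau_eq_zero_of_le ht, signProfile_eq_one (by linarith)]; ring

/-- `β = -1` on `(-∞, -1/2]`. [folklore] -/
theorem satProfile_eq_neg_one {t : ℝ} (ht : t ≤ -(1 / 2)) : satProfile t = -1 := by
  rw [satProfile, plateau_eq_zero_of_le_neg ht, signProfile_eq_neg_one (by linarith)]; ring

/-- `β > 0` on `(0, ∞)`. [folklore] -/
theorem satProfile_pos {t : ℝ} (ht : 0 < t) : 0 < satProfile t := by
  rw [satProfile]
  have h0 := plateau_nonneg t
  have h1 := plateau_le_one t
  have hs := signProfile_pos ht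
  rcases h0.lt_or_eq with h0' | h0'
  · exact add_pos_of_pos_of_nonneg (mul_pos h0' ht) (mul_nonneg (by linarith) hs.le)
  · rw [← h0']; simpa using hs

/-- `β < 0` on `(-∞, 0)`. [folklore] -/
theorem satProfile_neg {t : ℝ} (ht : t < 0) : satProfile t < 0 := by
  rw [satProfile]
  have h0 := plateau_nonneg t
  have h1 := plateau_le_one t
  have hs := signProfile_neg ht
  rcases h0.lt_or_eq with h0' | h0'
  · exact add_neg_of_neg_of_nonpos (mul_neg_of_pos_of_neg h0' ht)
      (mul_nonpos_of_nonneg_of_nonpos (by linarith) hs.le)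
  · rw [← h0']; simpa using hs

/-- `β(t) > 0 ↔ t > 0`. [folklore] -/
theorem satProfile_pos_iff {t : ℝ} : 0 < satProfile t ↔ 0 < t := by
  refine ⟨fun h => ?_, satProfile_pos⟩
  rcases lt_trichotomy t 0 with ht | rfl | ht
  · exact absurd h (not_lt.2 (satProfile_neg ht).le)
  · rw [satProfile_zero] at h; exact absurd h (lt_irrefl 0)
  · exact ht

/-- `β(t) < 0 ↔ t < 0`. [folklore] -/
theorem satProfile_neg_iff {t : ℝ} : satProfile t < 0 ↔ t < 0 := by
  refine ⟨fun h => ?_, satProfile_neg⟩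
  rcases lt_trichotomy t 0 with ht | rfl | ht
  · exact ht
  · rw [satProfile_zero] at h; exact absurd h (lt_irrefl 0)
  · exact absurd h (not_lt.2 (satProfile_pos ht).le)

/-- `β(t) = 0 ↔ t = 0`. [folklore] -/
theorem satProfile_eq_zero_iff {t : ℝ} : satProfile t = 0 ↔ t = 0 := by
  refine ⟨fun h => ?_, fun h => h ▸ satProfile_zero⟩
  rcases lt_trichotomy t 0 with ht | rfl | ht
  · exact absurd h (satProfile_neg ht).ne
  · rfl
  · exact absurd h (satProfile_pos ht).ne'

/-- `β(t) ≥ 0 ↔ t ≥ 0`. [folklore] -/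
theorem satProfile_nonneg_iff {t : ℝ} : 0 ≤ satProfile t ↔ 0 ≤ t := by
  rw [← not_lt, satProfile_neg_iff, not_lt]

/-- `β(t) ≤ 0 ↔ t ≤ 0`. [folklore] -/
theorem satProfile_nonpos_iff {t : ℝ} : satProfile t ≤ 0 ↔ t ≤ 0 := by
  rw [← not_lt, satProfile_pos_iff, not_lt]

/-- `β = id` on the neighbourhood `(-1/4, 1/4)` of `0`. [folklore] -/
theorem satProfile_eventuallyEq_id : satProfile =ᶠ[nhds 0] id := by
  have : Ioo (-(1 / 4 : ℝ)) (1 / 4) ∈ nhds (0 : ℝ) := Ioo_mem_nhds (by norm_num) (by norm_num)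
  filter_upwards [this] with t ht
  exact satProfile_eq_self (abs_le.2 ⟨ht.1.le, ht.2.le⟩)


/-! ### §2 Tubes of a smoothly embedded codimension-one sphere -/

/-- The unit vector `e₀` of the fibre `ℝ¹`. [folklore] -/
def e₀ : 𝔼 1 := EuclideanSpace.single 0 1

/-- The coordinate of `e₀` is `1`. [folklore] -/
@[simp] theorem e₀_apply_zero : e₀ 0 = 1 := by simp [e₀]

/-- Every vector of `ℝ¹` is a multiple of `e₀`. [folklore] -/
theorem smul_e₀_eq (w : 𝔼 1) : (w 0) • e₀ = w := by
  ext i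
  fin_cases i
  simp [e₀]

/-- The coordinate of `t e₀` is `t`. [folklore] -/
@[simp] theorem smul_e₀_apply_zero (t : ℝ) : (t • e₀) 0 = t := by simp [e₀]

variable {m : ℕ}

/-- **Tube data** of a map `f : 𝕊 m → 𝕊 (m+1)`: a smooth embedding `τ : 𝕊 m × ℝ¹ → 𝕊 (m+1)` with
open range whose zero section is `f` — an open bicollar of the hypersurface `f`.  (Proof
infrastructure: an explicit map with hypotheses, not a `Prop`-valued fact; it exists for every
smooth embedding, `nonempty_tubeData`.) [cite: HirschDT1976, Ch. 4 §5 Thms. 5.1–5.2] -/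
structure TubeData (f : 𝕊 m → 𝕊 (m + 1)) where
  /-- the tube map -/
  τ : (𝕊 m) × 𝔼 1 → 𝕊 (m + 1)
  /-- the tube map is a smooth embedding -/
  isSmoothEmbedding :
    Manifold.IsSmoothEmbedding ((𝓡 m).prod 𝓘(ℝ, 𝔼 1)) (𝓡 (m + 1)) ∞ τ
  /-- the tube is open -/
  isOpen_range : IsOpen (range τ)
  /-- the zero section of the tube is `f` -/
  apply_zero : ∀ x, τ (x, 0) = f x

/-- **Every smoothly embedded codimension-one sphere in a sphere has tube data**: the tube of the
normal framing by the normal field (`SphereHypersurface.isNormalFraming_normalField`,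
`IsNormalFraming.exists_isSmoothEmbedding_tube_of_isSmoothEmbedding`).
[cite: HirschDT1976, Ch. 4 §5 Thms. 5.1–5.2] -/
theorem nonempty_tubeData {f : 𝕊 m → 𝕊 (m + 1)}
    (hf : Manifold.IsSmoothEmbedding (𝓡 m) (𝓡 (m + 1)) ∞ f) : Nonempty (TubeData f) := by
  haveI := Fact.mk (@finrank_euclideanSpace_fin ℝ _ (m + 1 + 1))
  obtain ⟨F, _, _, hF⟩ := hf.isImmersion
  have hfr := SphereHypersurface.isNormalFraming_normalField hf.contMDiff
    (fun x => Manifold.IsImmersionAtOfComplement.mfderiv_injective (hF x) (by simp))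
  obtain ⟨ε, -, hemb, hopen⟩ := hfr.exists_isSmoothEmbedding_tube_of_isSmoothEmbedding
    (n := m + 1) hf (by simp)
  exact ⟨⟨hfr.tube ε, hemb, hopen, fun x => hfr.tube_apply_zero ε x⟩⟩

namespace TubeData

variable {f : 𝕊 m → 𝕊 (m + 1)} (D : TubeData f)

/-- The tube map is injective. [folklore] -/
theorem injective : Injective D.τ := D.isSmoothEmbedding.isEmbedding.injective

/-- The tube map is continuous. [folklore] -/
theorem continuous : Continuous D.τ := D.isSmoothEmbedding.contMDiff.continuous

/-- The tube map is an open embedding. [folklore] -/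
theorem isOpenEmbedding : Topology.IsOpenEmbedding D.τ :=
  ⟨D.isSmoothEmbedding.isEmbedding, D.isOpen_range⟩

/-- The tube as a partial homeomorphism `𝕊 m × ℝ¹ ≃ range τ`. [folklore] -/
def chart : OpenPartialHomeomorph ((𝕊 m) × 𝔼 1) (𝕊 (m + 1)) :=
  D.isOpenEmbedding.toOpenPartialHomeomorph D.τ

/-- The tube chart acts as `τ`. [folklore] -/
@[simp] theorem chart_apply (q : (𝕊 m) × 𝔼 1) : D.chart q = D.τ q := rfl

/-- The tube chart is defined everywhere. [folklore] -/
theorem chart_source : D.chart.source = univ := by simp [chart]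

/-- The target of the tube chart is the tube. [folklore] -/
theorem chart_target : D.chart.target = range D.τ := by simp [chart]

/-- `τ⁻¹ ∘ τ = id`. [folklore] -/
@[simp] theorem chart_symm_apply (q : (𝕊 m) × 𝔼 1) : D.chart.symm (D.τ q) = q :=
  D.chart.left_inv (by simp [chart_source])

/-- `τ⁻¹` is smooth on the tube (the inverse of an open smooth embedding is smooth). [folklore] -/
theorem contMDiffOn_chart_symm :
    ContMDiffOn (𝓡 (m + 1)) ((𝓡 m).prod 𝓘(ℝ, 𝔼 1)) ∞ D.chart.symm (range D.τ) :=
  contMDiffOn_symm_of_isSmoothEmbedding D.isSmoothEmbedding D.isOpenEmbedding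

/-- The **height** in the tube: the fibre coordinate of `τ⁻¹`, extended by junk off the tube.
[folklore] -/
def coord (z : 𝕊 (m + 1)) : ℝ := (D.chart.symm z).2 0

/-- The height of `τ(x, w)` is `w`. [folklore] -/
@[simp] theorem coord_apply (x : 𝕊 m) (w : 𝔼 1) : D.coord (D.τ (x, w)) = w 0 := by
  simp [coord]

/-- The height is smooth on the tube. [folklore] -/
theorem contMDiffOn_coord : ContMDiffOn (𝓡 (m + 1)) 𝓘(ℝ, ℝ) ∞ D.coord (range D.τ) := by
  have h1 : ContMDiff ((𝓡 m).prod 𝓘(ℝ, 𝔼 1)) 𝓘(ℝ, ℝ) ∞ fun q : (𝕊 m) × 𝔼 1 => q.2 0 :=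
    ((EuclideanSpace.proj (0 : Fin 1) : 𝔼 1 →L[ℝ] ℝ).contMDiff).comp contMDiff_snd
  exact h1.comp_contMDiffOn D.contMDiffOn_chart_symm

/-! ### §3 The collar and its two sides -/

/-- The closed collar `h(x, t) = τ(x, t e₀)`, `t ∈ [-1, 1]`, a continuous injection of the
cylinder `𝕊 m × [-1, 1]` (the bicollar of `SphereHypersurfaceCollar.lean`). [folklore] -/
def collar (p : (𝕊 m) × Icc (-1 : ℝ) 1) : 𝕊 (m + 1) := D.τ (p.1, (p.2 : ℝ) • e₀)

/-- Unfolding lemma for the collar. [folklore] -/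
theorem collar_apply (p : (𝕊 m) × Icc (-1 : ℝ) 1) : D.collar p = D.τ (p.1, (p.2 : ℝ) • e₀) := rfl

/-- The collar is continuous. [folklore] -/
theorem continuous_collar : Continuous D.collar :=
  D.continuous.comp (continuous_fst.prodMk
    ((continuous_subtype_val.comp continuous_snd).smul continuous_const))

/-- The collar is injective. [folklore] -/
theorem injective_collar : Injective D.collar := by
  rintro ⟨x, t⟩ ⟨y, s⟩ hxy
  have h' := D.injective hxy
  simp only [Prod.mk.injEq] at h'
  obtain ⟨rfl, hts⟩ := h'
  have : (t : ℝ) = s := by simpa using congrArg (fun w : 𝔼 1 => w 0) hts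
  rw [Subtype.ext this]

/-- The height of the collar point `h(x, t)` is `t`. [folklore] -/
@[simp] theorem coord_collar (p : (𝕊 m) × Icc (-1 : ℝ) 1) : D.coord (D.collar p) = p.2 := by
  rw [collar_apply, coord_apply, smul_e₀_apply_zero]

/-- `h(x, 0) = f x`. [folklore] -/
theorem collar_eq_of_eq_zero {p : (𝕊 m) × Icc (-1 : ℝ) 1} (hp : (p.2 : ℝ) = 0) :
    D.collar p = f p.1 := by
  rw [collar_apply, hp, zero_smul, D.apply_zero]

/-- The middle sphere of the collar is the hypersurface `f`. [folklore] -/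
theorem image_collar_zero : D.collar '' {p | (p.2 : ℝ) = 0} = range f := by
  ext z
  constructor
  · rintro ⟨p, hp, rfl⟩
    exact ⟨p.1, (D.collar_eq_of_eq_zero hp).symm⟩
  · rintro ⟨x, rfl⟩
    exact ⟨(x, ⟨0, by norm_num, by norm_num⟩), rfl, D.collar_eq_of_eq_zero rfl⟩

/-- A tube point of height in `[-1, 1]` is a collar point. [folklore] -/
theorem apply_eq_collar (x : 𝕊 m) (w : 𝔼 1) (hw : w 0 ∈ Icc (-1 : ℝ) 1) :
    D.τ (x, w) = D.collar (x, ⟨w 0, hw⟩) := by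
  rw [collar_apply, smul_e₀_eq]

/-- **The far side `A`** of the top end of the collar (`collarSide`, `SchoenfliesSeparation.lean`).
[cite: Daverman1986, proof of Thm. II.6.6 (PDF p. 40)] -/
def sideA : Set (𝕊 (m + 1)) := collarSide D.collar

/-- **The far side `B`** of the bottom end of the collar. [cite: Daverman1986, proof of Thm. II.6.6 (PDF p. 40)] -/
def sideB : Set (𝕊 (m + 1)) := collarSide (D.collar ∘ cylinderFlip (m + 1))

/-- **The collar of a smooth hypersurface sphere has two sides** (`m ≥ 1`): Daverman's `A`, `B`
exist, by the separation theorem `IsTopSphere.isBicollarSides_collarSide` for the round sphere.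
[cite: Daverman1986, proof of Thm. II.6.6 (PDF p. 40)] -/
theorem isBicollarSides (hm : 1 ≤ m) : IsBicollarSides D.collar D.sideA D.sideB := by
  haveI := Fact.mk (@finrank_euclideanSpace_fin ℝ _ (m + 1 + 1))
  exact (isTopSphere_sphere (n := m + 1)).isBicollarSides_collarSide D.continuous_collar
    D.injective_collar (by omega)

/-! ### §4 The side function -/

open Classical in
/-- **The side function** `g`: `1` on the far side `A`, `-1` on the far side `B`, and the
saturated height `β(t)` at the collar point `h(x, t)`, `|t| < 1`. [folklore] -/
def sideFun (z : 𝕊 (m + 1)) : ℝ :=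
  if z ∈ D.sideA then 1 else if z ∈ D.sideB then -1 else satProfile (D.coord z)

/-- `g = 1` on `A`. [folklore] -/
theorem sideFun_of_mem_sideA {z : 𝕊 (m + 1)} (hz : z ∈ D.sideA) : D.sideFun z = 1 := by
  rw [sideFun, if_pos hz]

variable (hm : 1 ≤ m)
include hm

/-- A collar point lies in `A` iff it is on the top end `t = 1`. [folklore] -/
theorem collar_mem_sideA_iff (p : (𝕊 m) × Icc (-1 : ℝ) 1) :
    D.collar p ∈ D.sideA ↔ (p.2 : ℝ) = 1 :=
  (D.isBicollarSides hm).mem_left_iff p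

/-- A collar point lies in `B` iff it is on the bottom end `t = -1`. [folklore] -/
theorem collar_mem_sideB_iff (p : (𝕊 m) × Icc (-1 : ℝ) 1) :
    D.collar p ∈ D.sideB ↔ (p.2 : ℝ) = -1 :=
  (D.isBicollarSides hm).mem_right_iff p

/-- `g = -1` on `B`. [folklore] -/
theorem sideFun_of_mem_sideB {z : 𝕊 (m + 1)} (hz : z ∈ D.sideB) : D.sideFun z = -1 := by
  have hzA : z ∉ D.sideA := fun h => (D.isBicollarSides hm).disjoint.le_bot ⟨h, hz⟩
  rw [sideFun, if_neg hzA, if_pos hz]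

/-- On the whole closed collar the side function is the saturated height `β(t)`. [folklore] -/
theorem sideFun_collar (p : (𝕊 m) × Icc (-1 : ℝ) 1) : D.sideFun (D.collar p) = satProfile p.2 := by
  by_cases h1 : (p.2 : ℝ) = 1
  · rw [D.sideFun_of_mem_sideA ((D.collar_mem_sideA_iff hm p).2 h1), h1,
      satProfile_eq_one (by norm_num)]
  by_cases h2 : (p.2 : ℝ) = -1
  · rw [D.sideFun_of_mem_sideB hm ((D.collar_mem_sideB_iff hm p).2 h2), h2,
      satProfile_eq_neg_one (by norm_num)]
  rw [sideFun, if_neg (fun h => h1 ((D.collar_mem_sideA_iff hm p).1 h)),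
    if_neg (fun h => h2 ((D.collar_mem_sideB_iff hm p).1 h)), coord_collar]

/-- Every point lies in `A`, in `B`, or on the collar. [folklore] -/
theorem mem_sideA_or_mem_sideB_or_mem_range (z : 𝕊 (m + 1)) :
    z ∈ D.sideA ∨ z ∈ D.sideB ∨ z ∈ range D.collar := by
  by_cases hA : z ∈ D.sideA
  · exact Or.inl hA
  by_cases hB : z ∈ D.sideB
  · exact Or.inr (Or.inl hB)
  · exact Or.inr (Or.inr ((D.isBicollarSides hm).mem_range z hA hB))

/-! ### §5 The level sets of the side function -/

/-- `{g > 0} = A ∪ h(𝕊 m × (0, 1])` (`= D_A ∖ Σ`). [folklore] -/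
theorem setOf_sideFun_pos :
    {z | 0 < D.sideFun z} = D.sideA ∪ D.collar '' {p | 0 < (p.2 : ℝ)} := by
  ext z
  simp only [mem_setOf_eq, mem_union, mem_image]
  constructor
  · intro hz
    rcases D.mem_sideA_or_mem_sideB_or_mem_range hm z with hA | hB | ⟨p, rfl⟩
    · exact Or.inl hA
    · rw [D.sideFun_of_mem_sideB hm hB] at hz; norm_num at hz
    · rw [D.sideFun_collar hm] at hz
      exact Or.inr ⟨p, satProfile_pos_iff.1 hz, rfl⟩
  · rintro (hA | ⟨p, hp, rfl⟩)
    · rw [D.sideFun_of_mem_sideA hA]; norm_num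
    · rw [D.sideFun_collar hm]; exact satProfile_pos hp

/-- `{g ≥ 0} = A ∪ h(𝕊 m × [0, 1])` (`= D_A`). [folklore] -/
theorem setOf_sideFun_nonneg :
    {z | 0 ≤ D.sideFun z} = D.sideA ∪ D.collar '' {p | 0 ≤ (p.2 : ℝ)} := by
  ext z
  simp only [mem_setOf_eq, mem_union, mem_image]
  constructor
  · intro hz
    rcases D.mem_sideA_or_mem_sideB_or_mem_range hm z with hA | hB | ⟨p, rfl⟩
    · exact Or.inl hA
    · rw [D.sideFun_of_mem_sideB hm hB] at hz; norm_num at hz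
    · rw [D.sideFun_collar hm] at hz
      exact Or.inr ⟨p, satProfile_nonneg_iff.1 hz, rfl⟩
  · rintro (hA | ⟨p, hp, rfl⟩)
    · rw [D.sideFun_of_mem_sideA hA]; norm_num
    · rw [D.sideFun_collar hm]; exact satProfile_nonneg_iff.2 hp

/-- `{g < 0} = B ∪ h(𝕊 m × [-1, 0))` (`= D_B ∖ Σ`). [folklore] -/
theorem setOf_sideFun_neg :
    {z | D.sideFun z < 0} = D.sideB ∪ D.collar '' {p | (p.2 : ℝ) < 0} := by
  ext z
  simp only [mem_setOf_eq, mem_union, mem_image]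
  constructor
  · intro hz
    rcases D.mem_sideA_or_mem_sideB_or_mem_range hm z with hA | hB | ⟨p, rfl⟩
    · rw [D.sideFun_of_mem_sideA hA] at hz; norm_num at hz
    · exact Or.inl hB
    · rw [D.sideFun_collar hm] at hz
      exact Or.inr ⟨p, satProfile_neg_iff.1 hz, rfl⟩
  · rintro (hB | ⟨p, hp, rfl⟩)
    · rw [D.sideFun_of_mem_sideB hm hB]; norm_num
    · rw [D.sideFun_collar hm]; exact satProfile_neg hp

/-- `{g ≤ 0} = B ∪ h(𝕊 m × [-1, 0])` (`= D_B`). [folklore] -/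
theorem setOf_sideFun_nonpos :
    {z | D.sideFun z ≤ 0} = D.sideB ∪ D.collar '' {p | (p.2 : ℝ) ≤ 0} := by
  ext z
  simp only [mem_setOf_eq, mem_union, mem_image]
  constructor
  · intro hz
    rcases D.mem_sideA_or_mem_sideB_or_mem_range hm z with hA | hB | ⟨p, rfl⟩
    · rw [D.sideFun_of_mem_sideA hA] at hz; norm_num at hz
    · exact Or.inl hB
    · rw [D.sideFun_collar hm] at hz
      exact Or.inr ⟨p, satProfile_nonpos_iff.1 hz, rfl⟩
  · rintro (hB | ⟨p, hp, rfl⟩)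
    · rw [D.sideFun_of_mem_sideB hm hB]; norm_num
    · rw [D.sideFun_collar hm]; exact satProfile_nonpos_iff.2 hp

/-- **The zero level of the side function is the hypersurface**: `g⁻¹(0) = f(𝕊 m)`. [folklore] -/
theorem sideFun_preimage_zero : D.sideFun ⁻¹' {0} = range f := by
  rw [← D.image_collar_zero]
  ext z
  simp only [mem_preimage, mem_singleton_iff, mem_image, mem_setOf_eq]
  constructor
  · intro hz
    rcases D.mem_sideA_or_mem_sideB_or_mem_range hm z with hA | hB | ⟨p, rfl⟩
    · rw [D.sideFun_of_mem_sideA hA] at hz; norm_num at hz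
    · rw [D.sideFun_of_mem_sideB hm hB] at hz; norm_num at hz
    · rw [D.sideFun_collar hm] at hz
      exact ⟨p, satProfile_eq_zero_iff.1 hz, rfl⟩
  · rintro ⟨p, hp, rfl⟩
    rw [D.sideFun_collar hm, hp, satProfile_zero]

/-! ### §6 Smoothness of the side function -/

/-- The open middle part of the tube: tube points of height in `(-1, 1)`. [folklore] -/
def midOpen : Set (𝕊 (m + 1)) := range D.τ ∩ D.coord ⁻¹' Ioo (-1) 1

/-- The upper open piece `A ∪ h(𝕊 m × (1/2, 1])`, on which `g ≡ 1`. [folklore] -/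
def upperOpen : Set (𝕊 (m + 1)) := D.sideA ∪ D.collar '' {p | 1 / 2 < (p.2 : ℝ)}

/-- The lower open piece `B ∪ h(𝕊 m × [-1, -1/2))`, on which `g ≡ -1`. [folklore] -/
def lowerOpen : Set (𝕊 (m + 1)) := D.sideB ∪ D.collar '' {p | (p.2 : ℝ) < -(1 / 2)}

omit hm in
/-- The middle part of the tube is open. [folklore] -/
theorem isOpen_midOpen : IsOpen D.midOpen :=
  D.contMDiffOn_coord.continuousOn.isOpen_inter_preimage D.isOpen_range isOpen_Ioo

omit hm in
/-- Collar points of height in `(-1, 1)` lie in the middle part. [folklore] -/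
theorem collar_mem_midOpen {p : (𝕊 m) × Icc (-1 : ℝ) 1} (hp : (p.2 : ℝ) ∈ Ioo (-1 : ℝ) 1) :
    D.collar p ∈ D.midOpen :=
  ⟨⟨_, rfl⟩, by rw [mem_preimage, coord_collar]; exact hp⟩

/-- On the middle part `g = β ∘ height`. [folklore] -/
theorem sideFun_eq_of_mem_midOpen {z : 𝕊 (m + 1)} (hz : z ∈ D.midOpen) :
    D.sideFun z = satProfile (D.coord z) := by
  obtain ⟨⟨⟨x, w⟩, rfl⟩, hw⟩ := hz
  rw [mem_preimage, coord_apply] at hw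
  rw [coord_apply, D.apply_eq_collar x w ⟨hw.1.le, hw.2.le⟩, D.sideFun_collar hm]

/-- `g` is smooth on the middle part. [folklore] -/
theorem contMDiffOn_sideFun_midOpen : ContMDiffOn (𝓡 (m + 1)) 𝓘(ℝ, ℝ) ∞ D.sideFun D.midOpen :=
  ((contDiff_satProfile.contMDiff.comp_contMDiffOn D.contMDiffOn_coord).mono
    inter_subset_left).congr fun _ hz => D.sideFun_eq_of_mem_midOpen hm hz

/-- The upper piece is `(D_A ∖ Σ) ∖ h(𝕊 m × [0, 1/2])`. [folklore] -/
theorem upperOpen_eq : D.upperOpen = (D.sideA ∪ D.collar '' {p | 0 < (p.2 : ℝ)}) \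
    D.collar '' ({p | 0 ≤ (p.2 : ℝ)} ∩ {p | (p.2 : ℝ) ≤ 1 / 2}) := by
  ext z
  constructor
  · rintro (hA | ⟨p, hp, rfl⟩)
    · refine ⟨Or.inl hA, ?_⟩
      rintro ⟨q, hq, hqz⟩
      have h1 : ((q.2 : ℝ)) = 1 := (D.collar_mem_sideA_iff hm q).1 (by rw [hqz]; exact hA)
      have h2 : (q.2 : ℝ) ≤ 1 / 2 := hq.2
      linarith
    · have hp' : (1 / 2 : ℝ) < p.2 := hp
      refine ⟨Or.inr ⟨p, show (0 : ℝ) < p.2 by linarith, rfl⟩, ?_⟩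
      rintro ⟨q, hq, hqp⟩
      have h2 : (q.2 : ℝ) ≤ 1 / 2 := hq.2
      rw [D.injective_collar hqp] at h2
      linarith
  · rintro ⟨hA | ⟨p, hp, rfl⟩, hK⟩
    · exact Or.inl hA
    · have hp' : (0 : ℝ) < p.2 := hp
      refine Or.inr ⟨p, ?_, rfl⟩
      show (1 / 2 : ℝ) < p.2
      by_contra hle
      exact hK ⟨p, ⟨(hp'.le : (0 : ℝ) ≤ p.2), (not_lt.1 hle : (p.2 : ℝ) ≤ 1 / 2)⟩, rfl⟩

/-- The lower piece is `(D_B ∖ Σ) ∖ h(𝕊 m × [-1/2, 0])`. [folklore] -/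
theorem lowerOpen_eq : D.lowerOpen = (D.sideB ∪ D.collar '' {p | (p.2 : ℝ) < 0}) \
    D.collar '' ({p | (p.2 : ℝ) ≤ 0} ∩ {p | -(1 / 2) ≤ (p.2 : ℝ)}) := by
  ext z
  constructor
  · rintro (hB | ⟨p, hp, rfl⟩)
    · refine ⟨Or.inl hB, ?_⟩
      rintro ⟨q, hq, hqz⟩
      have h1 : ((q.2 : ℝ)) = -1 := (D.collar_mem_sideB_iff hm q).1 (by rw [hqz]; exact hB)
      have h2 : -(1 / 2) ≤ (q.2 : ℝ) := hq.2
      linarith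
    · have hp' : (p.2 : ℝ) < -(1 / 2) := hp
      refine ⟨Or.inr ⟨p, show (p.2 : ℝ) < 0 by linarith, rfl⟩, ?_⟩
      rintro ⟨q, hq, hqp⟩
      have h2 : -(1 / 2) ≤ (q.2 : ℝ) := hq.2
      rw [D.injective_collar hqp] at h2
      linarith
  · rintro ⟨hB | ⟨p, hp, rfl⟩, hK⟩
    · exact Or.inl hB
    · have hp' : (p.2 : ℝ) < 0 := hp
      refine Or.inr ⟨p, ?_, rfl⟩
      show (p.2 : ℝ) < -(1 / 2)
      by_contra hle
      exact hK ⟨p, ⟨(hp'.le : (p.2 : ℝ) ≤ 0), (not_lt.1 hle : -(1 / 2) ≤ (p.2 : ℝ))⟩, rfl⟩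

/-- The upper piece is open. [folklore] -/
theorem isOpen_upperOpen : IsOpen D.upperOpen := by
  rw [D.upperOpen_eq hm]
  refine (D.isBicollarSides hm).isOpen_left_union_image_pos.sdiff
    ((D.isBicollarSides hm).isClosed_image ?_)
  exact (isClosed_le continuous_const (continuous_subtype_val.comp continuous_snd)).inter
    (isClosed_le (continuous_subtype_val.comp continuous_snd) continuous_const)

/-- The lower piece is open. [folklore] -/
theorem isOpen_lowerOpen : IsOpen D.lowerOpen := by
  rw [D.lowerOpen_eq hm]
  have hopen : IsOpen (D.sideB ∪ D.collar '' {p | (p.2 : ℝ) < 0}) := by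
    have := (D.isBicollarSides hm).symm.isOpen_left_union_image_pos
    rwa [IsBicollarSides.image_flip_pos] at this
  refine hopen.sdiff ((D.isBicollarSides hm).isClosed_image ?_)
  exact (isClosed_le (continuous_subtype_val.comp continuous_snd) continuous_const).inter
    (isClosed_le continuous_const (continuous_subtype_val.comp continuous_snd))

/-- `g = 1` on the upper piece. [folklore] -/
theorem sideFun_eq_one_of_mem_upperOpen {z : 𝕊 (m + 1)} (hz : z ∈ D.upperOpen) :
    D.sideFun z = 1 := by
  rcases hz with hA | ⟨p, hp, rfl⟩
  · exact D.sideFun_of_mem_sideA hA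
  · rw [D.sideFun_collar hm]
    exact satProfile_eq_one (le_of_lt hp)

/-- `g = -1` on the lower piece. [folklore] -/
theorem sideFun_eq_neg_one_of_mem_lowerOpen {z : 𝕊 (m + 1)} (hz : z ∈ D.lowerOpen) :
    D.sideFun z = -1 := by
  rcases hz with hB | ⟨p, hp, rfl⟩
  · exact D.sideFun_of_mem_sideB hm hB
  · rw [D.sideFun_collar hm]
    exact satProfile_eq_neg_one (le_of_lt hp)

/-- `g` is smooth on the upper piece. [folklore] -/
theorem contMDiffOn_sideFun_upperOpen :
    ContMDiffOn (𝓡 (m + 1)) 𝓘(ℝ, ℝ) ∞ D.sideFun D.upperOpen :=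
  contMDiffOn_const.congr fun _ hz => D.sideFun_eq_one_of_mem_upperOpen hm hz

/-- `g` is smooth on the lower piece. [folklore] -/
theorem contMDiffOn_sideFun_lowerOpen :
    ContMDiffOn (𝓡 (m + 1)) 𝓘(ℝ, ℝ) ∞ D.sideFun D.lowerOpen :=
  contMDiffOn_const.congr fun _ hz => D.sideFun_eq_neg_one_of_mem_lowerOpen hm hz

/-- **The side function is smooth.** [folklore] -/
theorem contMDiff_sideFun : ContMDiff (𝓡 (m + 1)) 𝓘(ℝ, ℝ) ∞ D.sideFun := by
  apply contMDiff_of_locally_contMDiffOn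
  intro z
  rcases D.mem_sideA_or_mem_sideB_or_mem_range hm z with hA | hB | ⟨p, rfl⟩
  · exact ⟨_, D.isOpen_upperOpen hm, Or.inl hA, D.contMDiffOn_sideFun_upperOpen hm⟩
  · exact ⟨_, D.isOpen_lowerOpen hm, Or.inl hB, D.contMDiffOn_sideFun_lowerOpen hm⟩
  · rcases lt_or_ge (1 / 2 : ℝ) p.2 with h1 | h1
    · exact ⟨_, D.isOpen_upperOpen hm, Or.inr ⟨p, h1, rfl⟩, D.contMDiffOn_sideFun_upperOpen hm⟩
    rcases lt_or_ge (p.2 : ℝ) (-(1 / 2)) with h2 | h2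
    · exact ⟨_, D.isOpen_lowerOpen hm, Or.inr ⟨p, h2, rfl⟩, D.contMDiffOn_sideFun_lowerOpen hm⟩
    · exact ⟨_, D.isOpen_midOpen, D.collar_mem_midOpen ⟨by linarith, by linarith⟩,
        D.contMDiffOn_sideFun_midOpen hm⟩

/-! ### §7 `0` is a regular level of the side function -/

/-- Along the fibre `t ↦ τ(x, t e₀)` the side function is the height `t` near `t = 0`; hence the
points of the hypersurface are regular points of the side function. [folklore] -/
theorem not_isMCriticalPt_sideFun (x : 𝕊 m) : ¬ IsMCriticalPt (𝓡 (m + 1)) D.sideFun (f x) := by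
  set ℓ : ℝ → 𝕊 (m + 1) := fun t => D.τ (x, t • e₀) with hℓdef
  have hℓ : ContMDiff 𝓘(ℝ, ℝ) (𝓡 (m + 1)) ∞ ℓ :=
    D.isSmoothEmbedding.contMDiff.comp (contMDiff_const.prodMk (contMDiff_id.smul contMDiff_const))
  have heq : D.sideFun ∘ ℓ =ᶠ[𝓝 0] id := by
    have : Ioo (-(1 / 4 : ℝ)) (1 / 4) ∈ 𝓝 (0 : ℝ) := Ioo_mem_nhds (by norm_num) (by norm_num)
    filter_upwards [this] with t ht
    have ht' : t ∈ Icc (-1 : ℝ) 1 := ⟨by linarith [ht.1], by linarith [ht.2]⟩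
    show D.sideFun (D.τ (x, t • e₀)) = t
    rw [show D.τ (x, t • e₀) = D.collar (x, ⟨t, ht'⟩) from rfl, D.sideFun_collar hm]
    exact satProfile_eq_self (abs_le.2 ⟨ht.1.le, ht.2.le⟩)
  intro hcrit
  have hℓ0 : ℓ 0 = f x := by simp [hℓdef, D.apply_zero]
  have hg : MDifferentiableAt (𝓡 (m + 1)) 𝓘(ℝ, ℝ) D.sideFun (ℓ 0) :=
    (D.contMDiff_sideFun hm).mdifferentiableAt (by norm_cast)
  have h1 : mfderiv 𝓘(ℝ, ℝ) 𝓘(ℝ, ℝ) (D.sideFun ∘ ℓ) 0 = ContinuousLinearMap.id ℝ ℝ := by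
    rw [heq.mfderiv_eq]
    exact mfderiv_id
  have h2 : mfderiv 𝓘(ℝ, ℝ) 𝓘(ℝ, ℝ) (D.sideFun ∘ ℓ) 0 = 0 := by
    rw [mfderiv_comp 0 hg (hℓ.mdifferentiableAt (by norm_cast)), hℓ0]
    have hcrit' : mfderiv (𝓡 (m + 1)) 𝓘(ℝ, ℝ) D.sideFun (f x) = 0 := hcrit
    rw [hcrit']
    rfl
  have key : (ContinuousLinearMap.id ℝ ℝ : ℝ →L[ℝ] ℝ) = 0 := h1.symm.trans h2
  have := congrArg (fun L : ℝ →L[ℝ] ℝ => L 1) key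
  norm_num at this

/-- **`0` is a regular level of the side function, with level the hypersurface `f`.** [folklore] -/
theorem isRegularLevel_sideFun : IsRegularLevel (𝓡 (m + 1)) D.sideFun 0 where
  contMDiff := D.contMDiff_sideFun hm
  isInteriorPoint _ _ := BoundarylessManifold.isInteriorPoint' _
  not_isMCriticalPt z hz := by
    have hz' : z ∈ range f := by rw [← D.sideFun_preimage_zero hm]; exact hz
    obtain ⟨x, rfl⟩ := hz'
    exact D.not_isMCriticalPt_sideFun hm x

/-! ### §8 The two sides: connected, with closures the two cells -/

/-- **The open side `{g > 0}` is connected** (`D_A ∖ Σ ≅` open ball). [folklore] -/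
theorem isConnected_setOf_sideFun_pos : IsConnected {z | 0 < D.sideFun z} := by
  haveI := Fact.mk (@finrank_euclideanSpace_fin ℝ _ (m + 1 + 1))
  rw [D.setOf_sideFun_pos hm]
  obtain ⟨x₀⟩ := (inferInstance : Nonempty (𝕊 m))
  refine ⟨⟨D.collar (x₀, ⟨1, by norm_num, by norm_num⟩),
    Or.inl ((D.collar_mem_sideA_iff hm _).2 rfl)⟩, ?_⟩
  exact (D.isBicollarSides hm).isPreconnected_left_union_image_pos isTopSphere_sphere (by omega)

/-- **The open side `{g < 0}` is connected** (`D_B ∖ Σ ≅` open ball). [folklore] -/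
theorem isConnected_setOf_sideFun_neg : IsConnected {z | D.sideFun z < 0} := by
  haveI := Fact.mk (@finrank_euclideanSpace_fin ℝ _ (m + 1 + 1))
  rw [D.setOf_sideFun_neg hm]
  obtain ⟨x₀⟩ := (inferInstance : Nonempty (𝕊 m))
  refine ⟨⟨D.collar (x₀, ⟨-1, by norm_num, by norm_num⟩),
    Or.inl ((D.collar_mem_sideB_iff hm _).2 rfl)⟩, ?_⟩
  have := (D.isBicollarSides hm).symm.isPreconnected_left_union_image_pos isTopSphere_sphere
    (by omega)
  rwa [IsBicollarSides.image_flip_pos] at this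

omit hm in
/-- `{g > 0} ∪ {g < 0}` is the complement of the zero level. [folklore] -/
theorem setOf_pos_union_setOf_neg {g : 𝕊 (m + 1) → ℝ} :
    {z | 0 < g z} ∪ {z | g z < 0} = (g ⁻¹' {0})ᶜ := by
  ext z
  simp only [mem_union, mem_setOf_eq, mem_compl_iff, mem_preimage, mem_singleton_iff]
  constructor
  · rintro (h | h) <;> linarith
  · intro h
    rcases lt_trichotomy (g z) 0 with h' | h' | h'
    exacts [Or.inr h', (h h').elim, Or.inl h']

/-- **`{g > 0}` is the complementary component of the hypersurface through any of its points.**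
[folklore] -/
theorem connectedComponentIn_eq_setOf_sideFun_pos {z₀ : 𝕊 (m + 1)} (hz₀ : 0 < D.sideFun z₀) :
    connectedComponentIn (range f)ᶜ z₀ = {z | 0 < D.sideFun z} := by
  have hcont := (D.contMDiff_sideFun hm).continuous
  have hU : IsOpen {z | 0 < D.sideFun z} := isOpen_lt continuous_const hcont
  have hV : IsOpen {z | D.sideFun z < 0} := isOpen_lt hcont continuous_const
  have hUV : Disjoint {z | 0 < D.sideFun z} {z | D.sideFun z < 0} :=
    disjoint_left.2 fun z (h1 : 0 < D.sideFun z) (h2 : D.sideFun z < 0) => lt_asymm h1 h2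
  have hcover : (range f)ᶜ = {z | 0 < D.sideFun z} ∪ {z | D.sideFun z < 0} := by
    rw [setOf_pos_union_setOf_neg, D.sideFun_preimage_zero hm]
  apply subset_antisymm
  · exact isPreconnected_connectedComponentIn.subset_left_of_subset_union hU hV hUV
      (hcover ▸ connectedComponentIn_subset _ _)
      ⟨z₀, mem_connectedComponentIn (hcover ▸ Or.inl hz₀), hz₀⟩
  · exact (D.isConnected_setOf_sideFun_pos hm).isPreconnected.subset_connectedComponentIn hz₀
      (hcover ▸ subset_union_left)

/-- **`{g < 0}` is the complementary component of the hypersurface through any of its points.**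
[folklore] -/
theorem connectedComponentIn_eq_setOf_sideFun_neg {z₀ : 𝕊 (m + 1)} (hz₀ : D.sideFun z₀ < 0) :
    connectedComponentIn (range f)ᶜ z₀ = {z | D.sideFun z < 0} := by
  have hcont := (D.contMDiff_sideFun hm).continuous
  have hU : IsOpen {z | 0 < D.sideFun z} := isOpen_lt continuous_const hcont
  have hV : IsOpen {z | D.sideFun z < 0} := isOpen_lt hcont continuous_const
  have hVU : Disjoint {z | D.sideFun z < 0} {z | 0 < D.sideFun z} :=
    disjoint_left.2 fun z (h1 : D.sideFun z < 0) (h2 : 0 < D.sideFun z) => lt_asymm h1 h2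
  have hcover : (range f)ᶜ = {z | D.sideFun z < 0} ∪ {z | 0 < D.sideFun z} := by
    rw [union_comm, setOf_pos_union_setOf_neg, D.sideFun_preimage_zero hm]
  apply subset_antisymm
  · exact isPreconnected_connectedComponentIn.subset_left_of_subset_union hV hU hVU
      (hcover ▸ connectedComponentIn_subset _ _)
      ⟨z₀, mem_connectedComponentIn (hcover ▸ Or.inl hz₀), hz₀⟩
  · exact (D.isConnected_setOf_sideFun_neg hm).isPreconnected.subset_connectedComponentIn hz₀
      (hcover ▸ subset_union_left)

/-- **The closure of the side `{g > 0}` is `{g ≥ 0}` — Daverman's cell `D_A`.** [folklore] -/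
theorem closure_setOf_sideFun_pos : closure {z | 0 < D.sideFun z} = {z | 0 ≤ D.sideFun z} := by
  haveI := Fact.mk (@finrank_euclideanSpace_fin ℝ _ (m + 1 + 1))
  obtain ⟨x₀⟩ := (inferInstance : Nonempty (𝕊 m))
  set z₀ := D.collar (x₀, ⟨1, by norm_num, by norm_num⟩) with hz₀def
  have hz₀A : z₀ ∈ D.sideA := (D.collar_mem_sideA_iff hm _).2 rfl
  have hz₀ : 0 < D.sideFun z₀ := by rw [D.sideFun_of_mem_sideA hz₀A]; norm_num
  have key := (D.isBicollarSides hm).closure_connectedComponentIn_eq_left isTopSphere_sphere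
    (by omega) (Or.inl hz₀A : z₀ ∈ D.sideA ∪ D.collar '' {p | 0 < (p.2 : ℝ)})
  rw [D.image_collar_zero, D.connectedComponentIn_eq_setOf_sideFun_pos hm hz₀] at key
  rw [key, D.setOf_sideFun_nonneg hm]

/-- **The closure of the side `{g < 0}` is `{g ≤ 0}` — Daverman's cell `D_B`.** [folklore] -/
theorem closure_setOf_sideFun_neg : closure {z | D.sideFun z < 0} = {z | D.sideFun z ≤ 0} := by
  haveI := Fact.mk (@finrank_euclideanSpace_fin ℝ _ (m + 1 + 1))
  obtain ⟨x₀⟩ := (inferInstance : Nonempty (𝕊 m))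
  set z₀ := D.collar (x₀, ⟨-1, by norm_num, by norm_num⟩) with hz₀def
  have hz₀B : z₀ ∈ D.sideB := (D.collar_mem_sideB_iff hm _).2 rfl
  have hz₀ : D.sideFun z₀ < 0 := by rw [D.sideFun_of_mem_sideB hm hz₀B]; norm_num
  have key := (D.isBicollarSides hm).closure_connectedComponentIn_eq_right isTopSphere_sphere
    (by omega) (Or.inl hz₀B : z₀ ∈ D.sideB ∪ D.collar '' {p | (p.2 : ℝ) < 0})
  rw [D.image_collar_zero, D.connectedComponentIn_eq_setOf_sideFun_neg hm hz₀] at key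
  rw [key, D.setOf_sideFun_nonpos hm]

/-- **`{g ≥ 0}` is an `(m+1)`-cell** (Brown's theorem, sided form). [cite: Daverman1986, Thm. II.6.6 (PDF p. 40)] -/
theorem nonempty_homeomorph_setOf_sideFun_nonneg :
    Nonempty ({z | 0 ≤ D.sideFun z} ≃ₜ closedBall (0 : 𝔼 (m + 1)) 1) := by
  haveI := Fact.mk (@finrank_euclideanSpace_fin ℝ _ (m + 1 + 1))
  rw [D.setOf_sideFun_nonneg hm]
  exact (D.isBicollarSides hm).nonempty_homeomorph_left isTopSphere_sphere (by omega)

/-- **`{g ≤ 0}` is an `(m+1)`-cell** (Brown's theorem, sided form). [cite: Daverman1986, Thm. II.6.6 (PDF p. 40)] -/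
theorem nonempty_homeomorph_setOf_sideFun_nonpos :
    Nonempty ({z | D.sideFun z ≤ 0} ≃ₜ closedBall (0 : 𝔼 (m + 1)) 1) := by
  haveI := Fact.mk (@finrank_euclideanSpace_fin ℝ _ (m + 1 + 1))
  rw [D.setOf_sideFun_nonpos hm]
  exact (D.isBicollarSides hm).nonempty_homeomorph_right isTopSphere_sphere (by omega)

end TubeData

/-! ### §9 The sides of a smoothly embedded codimension-one sphere -/

/-- **The side package** of a subset `Z ⊆ 𝕊 (m+1)` and a function `g`: `0` is a regular level of
`g` with level `Z`; the open sides `{g > 0}`, `{g < 0}` are connected, with closures `{g ≥ 0}`,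
`{g ≤ 0}`; and both closed sides are `(m+1)`-cells.  (A hypothesis structure bundling the
conclusions of `TubeData` §§7–8; not a named fact.) [folklore] -/
structure IsSidePackage (Z : Set (𝕊 (m + 1))) (g : 𝕊 (m + 1) → ℝ) : Prop where
  /-- `0` is a regular level of `g` -/
  isRegularLevel : IsRegularLevel (𝓡 (m + 1)) g 0
  /-- the zero level of `g` is `Z` -/
  preimage_zero : g ⁻¹' {0} = Z
  /-- the open side `{g > 0}` is connected -/
  isConnected_pos : IsConnected {z | 0 < g z}
  /-- the open side `{g < 0}` is connected -/
  isConnected_neg : IsConnected {z | g z < 0}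
  /-- the closure of `{g > 0}` is `{g ≥ 0}` -/
  closure_pos : closure {z | 0 < g z} = {z | 0 ≤ g z}
  /-- the closure of `{g < 0}` is `{g ≤ 0}` -/
  closure_neg : closure {z | g z < 0} = {z | g z ≤ 0}
  /-- the closed side `{g ≥ 0}` is an `(m+1)`-cell -/
  nonempty_homeomorph_nonneg : Nonempty ({z | 0 ≤ g z} ≃ₜ closedBall (0 : 𝔼 (m + 1)) 1)
  /-- the closed side `{g ≤ 0}` is an `(m+1)`-cell -/
  nonempty_homeomorph_nonpos : Nonempty ({z | g z ≤ 0} ≃ₜ closedBall (0 : 𝔼 (m + 1)) 1)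

namespace IsSidePackage

variable {Z : Set (𝕊 (m + 1))} {g : 𝕊 (m + 1) → ℝ}

/-- The side package is symmetric under `g ↦ -g` (exchange of the two sides). [folklore] -/
theorem neg (h : IsSidePackage Z g) : IsSidePackage Z (fun z => -g z) where
  isRegularLevel := by
    have := h.isRegularLevel.const_sub (a := 0)
    simp only [zero_sub] at this
    exact this
  preimage_zero := by
    rw [← h.preimage_zero]; ext z; simp
  isConnected_pos := by simpa only [neg_pos] using h.isConnected_neg
  isConnected_neg := by simpa only [neg_lt_zero] using h.isConnected_pos
  closure_pos := by simpa only [neg_pos, neg_nonneg] using h.closure_neg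
  closure_neg := by simpa only [neg_lt_zero, neg_nonpos] using h.closure_pos
  nonempty_homeomorph_nonneg := by
    obtain ⟨Φ⟩ := h.nonempty_homeomorph_nonpos
    have hs : {z | 0 ≤ -g z} = {z | g z ≤ 0} := by ext z; simp
    exact ⟨(Homeomorph.setCongr hs).trans Φ⟩
  nonempty_homeomorph_nonpos := by
    obtain ⟨Φ⟩ := h.nonempty_homeomorph_nonneg
    have hs : {z | -g z ≤ 0} = {z | 0 ≤ g z} := by ext z; simp
    exact ⟨(Homeomorph.setCongr hs).trans Φ⟩

/-- The side function of a side package is smooth. [folklore] -/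
theorem contMDiff (h : IsSidePackage Z g) : ContMDiff (𝓡 (m + 1)) 𝓘(ℝ, ℝ) ∞ g :=
  h.isRegularLevel.contMDiff

/-- The side function of a side package is continuous. [folklore] -/
theorem continuous (h : IsSidePackage Z g) : Continuous g := h.contMDiff.continuous

/-- The complement of `Z` is the disjoint union of the two open sides. [folklore] -/
theorem compl_eq (h : IsSidePackage Z g) : Zᶜ = {z | 0 < g z} ∪ {z | g z < 0} := by
  rw [TubeData.setOf_pos_union_setOf_neg, h.preimage_zero]

/-- The side `{g > 0}` is open. [folklore] -/
theorem isOpen_pos (h : IsSidePackage Z g) : IsOpen {z | 0 < g z} :=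
  isOpen_lt continuous_const h.continuous

/-- The side `{g < 0}` is open. [folklore] -/
theorem isOpen_neg (h : IsSidePackage Z g) : IsOpen {z | g z < 0} :=
  isOpen_lt h.continuous continuous_const

/-- The two open sides are disjoint. [folklore] -/
theorem disjoint (_h : IsSidePackage Z g) : Disjoint {z | 0 < g z} {z | g z < 0} :=
  disjoint_left.2 fun _ (h1 : 0 < g _) (h2 : g _ < 0) => lt_asymm h1 h2

/-- `{g > 0}` is the complementary component of `Z` through any of its points. [folklore] -/
theorem connectedComponentIn_eq_pos (h : IsSidePackage Z g) {z₀ : 𝕊 (m + 1)} (hz₀ : 0 < g z₀) :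
    connectedComponentIn Zᶜ z₀ = {z | 0 < g z} := by
  apply subset_antisymm
  · exact isPreconnected_connectedComponentIn.subset_left_of_subset_union h.isOpen_pos
      h.isOpen_neg h.disjoint (h.compl_eq ▸ connectedComponentIn_subset _ _)
      ⟨z₀, mem_connectedComponentIn (h.compl_eq ▸ Or.inl hz₀), hz₀⟩
  · exact h.isConnected_pos.isPreconnected.subset_connectedComponentIn hz₀
      (h.compl_eq ▸ subset_union_left)

/-- `{g < 0}` is the complementary component of `Z` through any of its points. [folklore] -/
theorem connectedComponentIn_eq_neg (h : IsSidePackage Z g) {z₀ : 𝕊 (m + 1)} (hz₀ : g z₀ < 0) :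
    connectedComponentIn Zᶜ z₀ = {z | g z < 0} := by
  have := h.neg.connectedComponentIn_eq_pos (z₀ := z₀) (by simpa using hz₀)
  simpa only [neg_pos] using this

/-- **The complement of `Z` is not connected** (Jordan–Brouwer separation). [folklore] -/
theorem not_isPreconnected_compl (h : IsSidePackage Z g) : ¬ IsPreconnected Zᶜ := by
  intro hc
  obtain ⟨a, ha⟩ := h.isConnected_pos.nonempty
  obtain ⟨b, hb⟩ := h.isConnected_neg.nonempty
  have hsub := hc.subset_left_of_subset_union h.isOpen_pos h.isOpen_neg h.disjoint
    h.compl_eq.subset ⟨a, h.compl_eq.symm.subset (Or.inl ha), ha⟩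
  have hb' : 0 < g b := hsub (h.compl_eq.symm.subset (Or.inr hb))
  exact lt_asymm hb' hb

/-- `Z` is the common frontier of the two open sides: `frontier {g > 0} = Z`. [folklore] -/
theorem frontier_pos (h : IsSidePackage Z g) : frontier {z | 0 < g z} = Z := by
  rw [frontier, h.closure_pos, h.isOpen_pos.interior_eq, ← h.preimage_zero]
  ext z
  simp only [Set.mem_sdiff, mem_setOf_eq, not_lt, mem_preimage, mem_singleton_iff]
  constructor
  · rintro ⟨h1, h2⟩; exact le_antisymm h2 h1
  · intro hz; exact ⟨hz.symm.le, hz.le⟩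

/-- `frontier {g < 0} = Z`. [folklore] -/
theorem frontier_neg (h : IsSidePackage Z g) : frontier {z | g z < 0} = Z := by
  simpa only [neg_pos] using h.neg.frontier_pos

/-! #### The closed sides as compact manifolds with boundary -/

/-- **The closed side `{g ≤ 0}` is connected** (as the regular sublevel manifold
`RegularSublevel`). [folklore] -/
theorem connectedSpace_regularSublevel (h : IsSidePackage Z g) :
    ConnectedSpace (RegularSublevel h.isRegularLevel) := by
  have : IsConnected {z | g z ≤ 0} := h.closure_neg ▸ h.isConnected_neg.closure
  exact isConnected_iff_connectedSpace.1 this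

/-- **The closed side `{g ≤ 0}` is an `(m+1)`-cell**, as the regular sublevel manifold.
[cite: Daverman1986, Thm. II.6.6 (PDF p. 40)] -/
theorem nonempty_homeomorph_regularSublevel (h : IsSidePackage Z g) :
    Nonempty (RegularSublevel h.isRegularLevel ≃ₜ closedBall (0 : 𝔼 (m + 1)) 1) :=
  h.nonempty_homeomorph_nonpos

/-- **The closed side `{g ≤ 0}` is contractible.** [folklore] -/
theorem contractibleSpace_regularSublevel (h : IsSidePackage Z g) :
    ContractibleSpace (RegularSublevel h.isRegularLevel) := by
  obtain ⟨Φ⟩ := h.nonempty_homeomorph_regularSublevel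
  haveI : ContractibleSpace (closedBall (0 : 𝔼 (m + 1)) 1) :=
    (convex_closedBall (0 : 𝔼 (m + 1)) 1).contractibleSpace ⟨0, mem_closedBall_self zero_le_one⟩
  exact Φ.contractibleSpace

/-- **The boundary of the closed side `{g ≤ 0}` is `Z`.** [cite: Milnor1963, Thm. 3.1] -/
theorem mem_boundary_regularSublevel_iff (h : IsSidePackage Z g)
    (p : RegularSublevel h.isRegularLevel) :
    p ∈ (𝓡∂ (m + 1)).boundary (RegularSublevel h.isRegularLevel) ↔
      RegularSublevel.incl h.isRegularLevel p ∈ Z := by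
  rw [RegularSublevel.mem_boundary_iff]
  have key : ∀ y, g y = 0 ↔ y ∈ Z := fun y => by rw [← h.preimage_zero]; rfl
  exact key _

/-- The superlevel side `{0 ≤ g}` is the sublevel side of `-g` (same carrier). [folklore] -/
theorem setOf_zero_sub_nonpos (_h : IsSidePackage Z g) :
    {z | (fun y => (0 : ℝ) - g y) z ≤ 0} = {z | 0 ≤ g z} := by
  ext z; simp

/-- **The closed side `{g ≥ 0}` is connected** (as the regular superlevel manifold). [folklore] -/
theorem connectedSpace_regularSuperlevel (h : IsSidePackage Z g) :
    ConnectedSpace (RegularSuperlevel h.isRegularLevel) := by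
  have h1 : IsConnected {z | 0 ≤ g z} := h.closure_pos ▸ h.isConnected_pos.closure
  rw [← h.setOf_zero_sub_nonpos] at h1
  exact isConnected_iff_connectedSpace.1 h1

/-- **The closed side `{g ≥ 0}` is an `(m+1)`-cell**, as the regular superlevel manifold.
[cite: Daverman1986, Thm. II.6.6 (PDF p. 40)] -/
theorem nonempty_homeomorph_regularSuperlevel (h : IsSidePackage Z g) :
    Nonempty (RegularSuperlevel h.isRegularLevel ≃ₜ closedBall (0 : 𝔼 (m + 1)) 1) := by
  obtain ⟨Φ⟩ := h.nonempty_homeomorph_nonneg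
  exact ⟨(Homeomorph.setCongr h.setOf_zero_sub_nonpos).trans Φ⟩

/-- **The closed side `{g ≥ 0}` is contractible.** [folklore] -/
theorem contractibleSpace_regularSuperlevel (h : IsSidePackage Z g) :
    ContractibleSpace (RegularSuperlevel h.isRegularLevel) := by
  obtain ⟨Φ⟩ := h.nonempty_homeomorph_regularSuperlevel
  haveI : ContractibleSpace (closedBall (0 : 𝔼 (m + 1)) 1) :=
    (convex_closedBall (0 : 𝔼 (m + 1)) 1).contractibleSpace ⟨0, mem_closedBall_self zero_le_one⟩
  exact Φ.contractibleSpace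

/-- **The boundary of the closed side `{g ≥ 0}` is `Z`.** [cite: Milnor1963, Thm. 3.1] -/
theorem mem_boundary_regularSuperlevel_iff (h : IsSidePackage Z g)
    (p : RegularSuperlevel h.isRegularLevel) :
    p ∈ (𝓡∂ (m + 1)).boundary (RegularSuperlevel h.isRegularLevel) ↔
      RegularSublevel.incl h.isRegularLevel.const_sub p ∈ Z := by
  rw [RegularSublevel.mem_boundary_iff]
  have key : ∀ y, (0 : ℝ) - g y = 0 ↔ y ∈ Z := fun y => by
    rw [← h.preimage_zero, zero_sub, neg_eq_zero]; rfl
  exact key _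

end IsSidePackage

/-- **The side function of tube data is a side package.** [folklore] -/
theorem TubeData.isSidePackage_sideFun {f : 𝕊 m → 𝕊 (m + 1)} (D : TubeData f) (hm : 1 ≤ m) :
    IsSidePackage (range f) D.sideFun where
  isRegularLevel := D.isRegularLevel_sideFun hm
  preimage_zero := D.sideFun_preimage_zero hm
  isConnected_pos := D.isConnected_setOf_sideFun_pos hm
  isConnected_neg := D.isConnected_setOf_sideFun_neg hm
  closure_pos := D.closure_setOf_sideFun_pos hm
  closure_neg := D.closure_setOf_sideFun_neg hm
  nonempty_homeomorph_nonneg := D.nonempty_homeomorph_setOf_sideFun_nonneg hm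
  nonempty_homeomorph_nonpos := D.nonempty_homeomorph_setOf_sideFun_nonpos hm

/-- **Main theorem (the sides of a smooth hypersurface sphere).**  For a smooth embedding
`f : 𝕊 m → 𝕊 (m+1)`, `m ≥ 1`, there is a smooth function `g : 𝕊 (m+1) → ℝ` with regular level
`g⁻¹(0) = f(𝕊 m)` whose open sides `{g > 0}`, `{g < 0}` are the two (connected) complementary
components of `f(𝕊 m)`, with closures the `(m+1)`-cells `{g ≥ 0}`, `{g ≤ 0}`.
[cite: HirschDT1976, Ch. 4 §5 Thms. 5.1–5.2] [cite: Daverman1986, Thm. II.6.6 (PDF p. 40)] -/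
theorem exists_isSidePackage (hm : 1 ≤ m) {f : 𝕊 m → 𝕊 (m + 1)}
    (hf : Manifold.IsSmoothEmbedding (𝓡 m) (𝓡 (m + 1)) ∞ f) :
    ∃ g : 𝕊 (m + 1) → ℝ, IsSidePackage (range f) g := by
  obtain ⟨D⟩ := nonempty_tubeData hf
  exact ⟨D.sideFun, D.isSidePackage_sideFun hm⟩

/-- **Main theorem, pointed form**: the side function may be chosen negative at any given point
off the hypersurface (so that the prescribed point lies in the interior of the sublevel side
`{g ≤ 0}`). [folklore] -/
theorem exists_isSidePackage_neg (hm : 1 ≤ m) {f : 𝕊 m → 𝕊 (m + 1)}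
    (hf : Manifold.IsSmoothEmbedding (𝓡 m) (𝓡 (m + 1)) ∞ f) {p : 𝕊 (m + 1)} (hp : p ∉ range f) :
    ∃ g : 𝕊 (m + 1) → ℝ, IsSidePackage (range f) g ∧ g p < 0 := by
  obtain ⟨g, hg⟩ := exists_isSidePackage hm hf
  rcases lt_trichotomy (g p) 0 with h | h | h
  · exact ⟨g, hg, h⟩
  · have h' : p ∈ g ⁻¹' {0} := h
    rw [hg.preimage_zero] at h'
    exact (hp h').elim
  · exact ⟨fun z => -g z, hg.neg, by simpa using h⟩

/-- **Main theorem, unbundled form** (no auxiliary structure in the statement): for a smooth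
embedding `f : 𝕊 m → 𝕊 (m+1)`, `m ≥ 1`, there is `g : 𝕊 (m+1) → ℝ` with `0` a regular level,
`g⁻¹(0) = f(𝕊 m)`, `{g > 0}` and `{g < 0}` connected with closures `{g ≥ 0}` and `{g ≤ 0}`, both
of which are homeomorphic to the closed `(m+1)`-ball.
[cite: HirschDT1976, Ch. 4 §5 Thms. 5.1–5.2] [cite: Daverman1986, Thm. II.6.6 (PDF p. 40)] -/
theorem exists_isRegularLevel_sides (hm : 1 ≤ m) {f : 𝕊 m → 𝕊 (m + 1)}
    (hf : Manifold.IsSmoothEmbedding (𝓡 m) (𝓡 (m + 1)) ∞ f) :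
    ∃ g : 𝕊 (m + 1) → ℝ, IsRegularLevel (𝓡 (m + 1)) g 0 ∧ g ⁻¹' {0} = range f ∧
      IsConnected {z | 0 < g z} ∧ IsConnected {z | g z < 0} ∧
      closure {z | 0 < g z} = {z | 0 ≤ g z} ∧ closure {z | g z < 0} = {z | g z ≤ 0} ∧
      Nonempty ({z | 0 ≤ g z} ≃ₜ closedBall (0 : 𝔼 (m + 1)) 1) ∧
      Nonempty ({z | g z ≤ 0} ≃ₜ closedBall (0 : 𝔼 (m + 1)) 1) := by
  obtain ⟨g, hg⟩ := exists_isSidePackage hm hf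
  exact ⟨g, hg.isRegularLevel, hg.preimage_zero, hg.isConnected_pos, hg.isConnected_neg,
    hg.closure_pos, hg.closure_neg, hg.nonempty_homeomorph_nonneg, hg.nonempty_homeomorph_nonpos⟩

/-- **Jordan–Brouwer separation for smooth hypersurface spheres**: the complement of a smoothly
embedded `𝕊 m` in `𝕊 (m+1)`, `m ≥ 1`, is not connected; it is the disjoint union of two connected
open sets, each with frontier the hypersurface. [cite: Daverman1986, Thm. II.6.6 (PDF p. 40)] -/
theorem exists_two_sides (hm : 1 ≤ m) {f : 𝕊 m → 𝕊 (m + 1)}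
    (hf : Manifold.IsSmoothEmbedding (𝓡 m) (𝓡 (m + 1)) ∞ f) :
    ∃ U V : Set (𝕊 (m + 1)), IsOpen U ∧ IsOpen V ∧ IsConnected U ∧ IsConnected V ∧
      Disjoint U V ∧ U ∪ V = (range f)ᶜ ∧ frontier U = range f ∧ frontier V = range f := by
  obtain ⟨g, hg⟩ := exists_isSidePackage hm hf
  exact ⟨_, _, hg.isOpen_pos, hg.isOpen_neg, hg.isConnected_pos, hg.isConnected_neg, hg.disjoint,
    hg.compl_eq.symm, hg.frontier_pos, hg.frontier_neg⟩

/-- **The sides as compact manifolds with boundary** ("the hypersurface bounds, on both sides"):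
for a smooth embedding `f : 𝕊 m → 𝕊 (m+1)`, `m ≥ 1`, there is a regular level `g⁻¹(0) = f(𝕊 m)`
whose regular sublevel manifold `W = {g ≤ 0}` and regular superlevel manifold `W' = {g ≥ 0}`
(compact smooth `(m+1)`-manifolds with boundary, model `𝓡∂ (m+1)`, glued along `g⁻¹(0)` to give
`𝕊 (m+1)`, `RegularSublevel.isBoundaryGluing_split`) are connected, contractible, homeomorphic to
the closed `(m+1)`-ball, with boundary exactly the points of `f(𝕊 m)`.
[cite: Milnor1963, Thm. 3.1] [cite: Daverman1986, Thm. II.6.6 (PDF p. 40)] -/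
theorem exists_isRegularLevel_regularSublevel (hm : 1 ≤ m) {f : 𝕊 m → 𝕊 (m + 1)}
    (hf : Manifold.IsSmoothEmbedding (𝓡 m) (𝓡 (m + 1)) ∞ f) :
    ∃ (g : 𝕊 (m + 1) → ℝ) (h0 : IsRegularLevel (𝓡 (m + 1)) g 0), g ⁻¹' {0} = range f ∧
      ConnectedSpace (RegularSublevel h0) ∧ ContractibleSpace (RegularSublevel h0) ∧
      Nonempty (RegularSublevel h0 ≃ₜ closedBall (0 : 𝔼 (m + 1)) 1) ∧
      (∀ p : RegularSublevel h0,
        p ∈ (𝓡∂ (m + 1)).boundary (RegularSublevel h0) ↔ RegularSublevel.incl h0 p ∈ range f) ∧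
      ConnectedSpace (RegularSuperlevel h0) ∧ ContractibleSpace (RegularSuperlevel h0) ∧
      Nonempty (RegularSuperlevel h0 ≃ₜ closedBall (0 : 𝔼 (m + 1)) 1) ∧
      (∀ p : RegularSuperlevel h0, p ∈ (𝓡∂ (m + 1)).boundary (RegularSuperlevel h0) ↔
        RegularSublevel.incl h0.const_sub p ∈ range f) := by
  obtain ⟨g, hg⟩ := exists_isSidePackage hm hf
  exact ⟨g, hg.isRegularLevel, hg.preimage_zero, hg.connectedSpace_regularSublevel,
    hg.contractibleSpace_regularSublevel, hg.nonempty_homeomorph_regularSublevel,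
    hg.mem_boundary_regularSublevel_iff, hg.connectedSpace_regularSuperlevel,
    hg.contractibleSpace_regularSuperlevel, hg.nonempty_homeomorph_regularSuperlevel,
    hg.mem_boundary_regularSuperlevel_iff⟩

/-! ### §10 Bundled sphere embeddings; the `2`-sphere in the `3`-sphere -/

/-- **The sides of a bundled `SphereEmbedding m (m+1)`** (`Knots.lean`), `m ≥ 1`. [folklore] -/
theorem _root_.Literature.Topology.FourManifolds.SphereEmbedding.exists_isSidePackage (hm : 1 ≤ m)
    (S : SphereEmbedding m (m + 1)) : ∃ g : 𝕊 (m + 1) → ℝ, IsSidePackage (range S) g :=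
  SphereHypersurfaceSides.exists_isSidePackage hm S.isSmoothEmbedding

/-- **The sides of a bundled `SphereEmbedding m (m+1)`, pointed**: the prescribed point `p ∉ S`
lies in the open side `{g < 0}`. [folklore] -/
theorem _root_.Literature.Topology.FourManifolds.SphereEmbedding.exists_isSidePackage_neg
    (hm : 1 ≤ m) (S : SphereEmbedding m (m + 1)) {p : 𝕊 (m + 1)} (hp : p ∉ range S) :
    ∃ g : 𝕊 (m + 1) → ℝ, IsSidePackage (range S) g ∧ g p < 0 :=
  SphereHypersurfaceSides.exists_isSidePackage_neg hm S.isSmoothEmbedding hp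

/-- **A smooth `2`-sphere in `S³` bounds compact smooth `3`-manifolds with boundary on both sides**
— the objects of which the Schoenflies theorem in `S³` (Schultens 2014, Thm. 3.2.5 with
Cor. 3.2.6: "any 2-sphere in `ℝ³` bounds a 3-ball"; the tree's named fact
`SphereEmbedding.schoenflies_exists_ball`) asserts that they are smooth `3`-balls: here they are
shown to be compact, connected, contractible smooth `3`-manifolds with boundary the sphere,
homeomorphic to the closed `3`-ball (Brown).  The smooth identification with `𝔻³` is NOT proved
here. [cite: Schultens2014, Thm. 3.2.5 and Cor. 3.2.6 (PDF pp. 43, 45)] [cite: Daverman1986, Thm. II.6.6 (PDF p. 40)] -/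
theorem _root_.Literature.Topology.FourManifolds.SphereEmbedding.exists_sides_two_three
    (S : SphereEmbedding 2 3) :
    ∃ (g : 𝕊 3 → ℝ) (h0 : IsRegularLevel (𝓡 3) g 0), g ⁻¹' {0} = range S ∧
      ConnectedSpace (RegularSublevel h0) ∧ ContractibleSpace (RegularSublevel h0) ∧
      Nonempty (RegularSublevel h0 ≃ₜ closedBall (0 : 𝔼 3) 1) ∧
      (∀ p : RegularSublevel h0,
        p ∈ (𝓡∂ 3).boundary (RegularSublevel h0) ↔ RegularSublevel.incl h0 p ∈ range S) ∧
      ConnectedSpace (RegularSuperlevel h0) ∧ ContractibleSpace (RegularSuperlevel h0) ∧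
      Nonempty (RegularSuperlevel h0 ≃ₜ closedBall (0 : 𝔼 3) 1) ∧
      (∀ p : RegularSuperlevel h0, p ∈ (𝓡∂ 3).boundary (RegularSuperlevel h0) ↔
        RegularSublevel.incl h0.const_sub p ∈ range S) :=
  exists_isRegularLevel_regularSublevel (m := 2) (by norm_num) S.isSmoothEmbedding

end SphereHypersurfaceSides

end Literature.Topology.FourManifolds

end
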